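import Summits.Ventures.PercRepro.ProfileGapMonoThresholdNullityThreeTop

/-!
# PercRepro — THE TOP THRESHOLD AT NULLITY `4`, STEP 3: every independent deficient set has at least
`3 · (ρ(E) − 3)` units on a simple matroid (p5, gen 32; `proofs/P5-GM1.md` §44(c))

At nullity `#E = ρ(E) + 4`, co-rank `4`, on a simple matroid: a demanding set `B` of rank `3` with three coloops has
three points (`card_eq_three_of_card_coloops_eq_three`: the rest of `B` has rank `0`).  For an independent deficient
`B` (three points, spanning complement, a `5`-point plane `P = cl B`) write `K = P ∖ B` (two points),
`O = E ∖ P` (`ρ(E) − 1` points) and `𝒯 = {Y ⊆ O : #Y = 3, ρ(E ∖ Y) + 1 = ρ(E)}` (the transversal triples).  The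
UNITS of `B` are the pairs `(p, Y) ∈ K × 𝒯` with `ρ(Y ∪ p) = 4`; each gives the boundary target `Y ∪ p` with the
slack unit `p` (CorankTwo).  Two countings: `#𝒯 ≥ 2 (ρ(E) − 3)` (`two_mul_le_card_transversal`: at `ρ(E) = 5` every
triple of the four-point `O` is transversal, at `ρ(E) ≥ 6` the class bound `C(ρ(E) − 2, 2)`), and the FAILING pairs
(`ρ(Y ∪ p) ≠ 4`) number at most `ρ(E) − 3` (`sum_card_failures_le`): `E ∖ B` has `ρ(E) + 1` points and rank `ρ(E)`,
so its unique circuit `C₀ = (E ∖ B) ∖ coloops(E ∖ B)` (at least three points on a simple matroid,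
`three_le_card_circuit`) lies in every dependent subset (`circuit_subset_of_dependent`); if `K ∩ C₀ = ∅` only
`Y = C₀` fails (once per `p`), and if `p₀ ∈ K ∩ C₀` only `p₀` has failures, the triples `Y ⊇ C₀ ∖ p₀`, at most
`C(ρ(E) − 1 − #(C₀ ∖ p₀), 3 − #(C₀ ∖ p₀)) ≤ ρ(E) − 3` of them.  Hence **`card_units_ge`**:
`#units(B) ≥ 2 · #𝒯 − (ρ(E) − 3) ≥ 3 (ρ(E) − 3)`.  Nothing open is asserted.
-/

open scoped Matroid

namespace PercRepro.Cogirth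

open Finset ThmH Skew Shadow Profile

variable {α : Type} [DecidableEq α] {N : Matroid α} [N.Finite]

/-- `2 (r − 3) ≤ C(r − 2, 2)` for `6 ≤ r`. -/
theorem two_mul_sub_three_le_choose (r : ℕ) (hr : 6 ≤ r) : 2 * (r - 3) ≤ (r - 2).choose 2 := by
  obtain ⟨s, rfl⟩ : ∃ s, r = s + 6 := ⟨r - 6, by omega⟩
  rw [show s + 6 - 2 = s + 4 by omega, show s + 6 - 3 = s + 3 by omega, Nat.choose_two_right,
    show s + 4 - 1 = s + 3 by omega, Nat.le_div_iff_mul_le (by norm_num)]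
  nlinarith

/-- `C(r − 1 − d, 3 − d) ≤ r − 3` for `2 ≤ d` and `5 ≤ r`. -/
theorem choose_sub_le_sub_three (r d : ℕ) (hd : 2 ≤ d) (hr : 5 ≤ r) : (r - 1 - d).choose (3 - d) ≤ r - 3 := by
  rcases Nat.lt_or_ge d 3 with h | h
  · have hd2 : d = 2 := by omega
    subst hd2
    rw [show 3 - 2 = 1 by norm_num, Nat.choose_one_right]
    omega
  · rw [show 3 - d = 0 by omega, Nat.choose_zero_right]
    omega

section Units

variable (hpair : ∀ x ∈ gr N, ∀ y ∈ gr N, x ≠ y → rk N {x, y} = 2)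

include hpair in
/-- **On a simple matroid a rank-`3` set with three coloops has three points**: the rest of `B` has rank `0`
(`rk_sdiff_add_card_of_subset_coloops`), so any further point would be a loop. -/
theorem card_eq_three_of_card_coloops_eq_three {B : Finset α} (hB : B ∈ Rq N 3)
    (hκ : (coloops N B).card = 3) : B.card = 3 := by
  obtain ⟨hBg, hBr⟩ := mem_Rq.1 hB
  have hrk : rk N B = 3 := rk_eq_of_eRk_eq hBr
  have hCB : coloops N B ⊆ B := fun z hz => (mem_coloops.1 hz).1
  have h0 := rk_sdiff_add_card_of_subset_coloops hBg (Subset.refl (coloops N B))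
  rw [hκ, hrk] at h0
  have hcard := card_sdiff_add_card_eq_card hCB
  by_contra hne
  obtain ⟨x, hx⟩ : (B \ coloops N B).Nonempty := card_pos.1 (by omega)
  obtain ⟨y, hy⟩ : (coloops N B).Nonempty := card_pos.1 (by omega)
  have hxB : x ∈ B := (mem_sdiff.1 hx).1
  have hxy : x ≠ y := fun h => (mem_sdiff.1 hx).2 (h ▸ hy)
  have h2 := hpair x (hBg hxB) y (hBg (hCB hy)) hxy
  have h3 : rk N {x, y} ≤ rk N (B \ coloops N B) + 1 := by
    have h4 : rk N {x, y} ≤ rk N (insert y (B \ coloops N B)) :=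
      rk_mono' (M := N) (insert_subset (mem_insert_of_mem hx) (singleton_subset_iff.2 (mem_insert_self _ _)))
    exact h4.trans (rk_insert_le _ _)
  omega

variable (hn : (gr N).card = rk N (gr N) + 4)
  (hcf : ∀ z ∈ gr N, rk N ((gr N).erase z) = rk N (gr N))
  {B : Finset α} (hB : B ∈ Rq N 3) (hBsp : rk N (gr N \ B) = rk N (gr N)) (hcl : (clF N B).card = 5)
  (hB3 : B.card = 3)

include hn hcl in
/-- The complement of the plane has `ρ(E) − 1` points. -/
theorem card_sdiff_clF_of_nullity_four : (gr N \ clF N B).card = rk N (gr N) - 1 := by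
  have := card_sdiff_add_card_eq_card (clF_subset_gr (M := N) B)
  omega

include hB hcl hB3 in
/-- The plane minus the set has two points. -/
theorem card_clF_sdiff_of_nullity_four : (clF N B \ B).card = 2 := by
  have := card_sdiff_add_card_eq_card (subset_clF (mem_Rq.1 hB).1)
  omega

include hn hB hcl in
/-- **Every triple of the complement of the plane has co-rank at most `ρ(E) − 1`**: `E ∖ Y = cl B ∪ (O ∖ Y)` has rank
at most `3 + (ρ(E) − 4)`. -/
theorem rk_sdiff_le_of_triple {Y : Finset α} (hY : Y ∈ (gr N \ clF N B).powersetCard 3) :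
    rk N (gr N \ Y) ≤ rk N (gr N) - 1 := by
  obtain ⟨hYO, hYc⟩ := mem_powersetCard.1 hY
  have hsplit : gr N \ Y = clF N B ∪ ((gr N \ clF N B) \ Y) := by
    ext w
    simp only [mem_union, mem_sdiff]
    constructor
    · rintro ⟨hw, hwY⟩
      by_cases hc : w ∈ clF N B
      · exact Or.inl hc
      · exact Or.inr ⟨⟨hw, hc⟩, hwY⟩
    · rintro (hw | ⟨⟨hw, _⟩, hwY⟩)
      · exact ⟨clF_subset_gr B hw, fun hwY => (mem_sdiff.1 (hYO hwY)).2 hw⟩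
      · exact ⟨hw, hwY⟩
  have h1 := rk_union_le_rk_add_card (N := N) (clF N B) ((gr N \ clF N B) \ Y)
  have h2 : rk N (clF N B) = 3 := by rw [rk_clF]; exact rk_eq_of_eRk_eq (mem_Rq.1 hB).2
  have h3 := card_sdiff_add_card_eq_card hYO
  have h4 := card_sdiff_clF_of_nullity_four hn hcl
  have h5 : 4 ≤ rk N (gr N) := by
    have := rk_mono' (M := N) (clF_subset_gr (M := N) B)
    have := card_le_card (clF_subset_gr (M := N) B)
    have := rk_le_card' (M := N) (gr N)
    omega
  rw [hsplit]
  omega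

include hn hB hcl in
/-- **At rank `5` every triple of the (four-point) complement of the plane is transversal**: `E ∖ Y ⊇ B ∪ {o}` for the
fourth point `o`, of rank `4`. -/
theorem rk_sdiff_add_one_of_triple_of_rk_eq_five (hR5 : rk N (gr N) = 5) {Y : Finset α}
    (hY : Y ∈ (gr N \ clF N B).powersetCard 3) : rk N (gr N \ Y) + 1 = rk N (gr N) := by
  obtain ⟨hYO, hYc⟩ := mem_powersetCard.1 hY
  have hO := card_sdiff_clF_of_nullity_four hn hcl
  have hBg : B ⊆ gr N := (mem_Rq.1 hB).1
  obtain ⟨o, ho⟩ : ((gr N \ clF N B) \ Y).Nonempty := by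
    apply card_pos.1
    have := card_sdiff_add_card_eq_card hYO
    omega
  obtain ⟨hoO, hoY⟩ := mem_sdiff.1 ho
  obtain ⟨hog, hocl⟩ := mem_sdiff.1 hoO
  have hsub : insert o B ⊆ gr N \ Y := by
    intro x hx
    rcases mem_insert.1 hx with rfl | hx
    · exact mem_sdiff.2 ⟨hog, hoY⟩
    · exact mem_sdiff.2 ⟨hBg hx, fun hxY => (mem_sdiff.1 (hYO hxY)).2 (subset_clF hBg hx)⟩
  have h1 : rk N (insert o B) = 4 := by
    rw [rk_insert_eq hog hBg, if_neg hocl]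
    have : rk N B = 3 := rk_eq_of_eRk_eq (mem_Rq.1 hB).2
    omega
  have h2 := rk_mono' (M := N) hsub
  have h3 := rk_sdiff_le_of_triple hn hB hcl hY
  omega

include hn hcf hB hBsp hcl in
/-- **The transversal triples number at least `2 (ρ(E) − 3)`** (`ρ(E) ≥ 5`): all four at rank `5`, at least
`C(ρ(E) − 2, 2)` (the class bound) at rank `≥ 6`. -/
theorem two_mul_le_card_transversal (hR : 5 ≤ rk N (gr N)) :
    2 * (rk N (gr N) - 3) ≤
      (((gr N \ clF N B).powersetCard 3).filter (fun Y => rk N (gr N \ Y) + 1 = rk N (gr N))).card := by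
  rcases Nat.lt_or_ge (rk N (gr N)) 6 with h5 | h6
  · have hR5 : rk N (gr N) = 5 := by omega
    have hall : ((gr N \ clF N B).powersetCard 3).filter (fun Y => rk N (gr N \ Y) + 1 = rk N (gr N)) =
        (gr N \ clF N B).powersetCard 3 := by
      apply filter_true_of_mem
      intro Y hY
      exact rk_sdiff_add_one_of_triple_of_rk_eq_five hn hB hcl hR5 hY
    rw [hall, card_powersetCard, card_sdiff_clF_of_nullity_four hn hcl, hR5]
    decide
  · have hF : (clF N B).card + rk N (gr N) = (gr N).card + (4 - 3) := by omega
    have hB' : B ∈ Rq N (4 - 1) := hB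
    have h := card_transversal_triples_ge hcf hB' hF (by norm_num) (by omega)
    rw [card_sdiff_clF_of_nullity_four hn hcl] at h
    have h2 := two_mul_sub_three_le_choose (rk N (gr N)) h6
    rw [show rk N (gr N) - 1 - 1 = rk N (gr N) - 2 by omega] at h
    exact h2.trans h

include hB hBsp in
/-- **A dependent subset of `E ∖ B` contains its circuit `C₀ = (E ∖ B) ∖ coloops(E ∖ B)`**: a point `z` of `E ∖ B`
outside a dependent `X ⊆ E ∖ B` is a coloop of `E ∖ B` (`ρ((E ∖ B) ∖ z) ≤ #(E ∖ B) − 2 < ρ(E ∖ B)`). -/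
theorem circuit_subset_of_dependent (hn : (gr N).card = rk N (gr N) + 4) (hB3 : B.card = 3) {X : Finset α}
    (hX : X ⊆ gr N \ B) (hdep : rk N X < X.card) : (gr N \ B) \ coloops N (gr N \ B) ⊆ X := by
  intro z hz
  obtain ⟨hzZ, hzc⟩ := mem_sdiff.1 hz
  by_contra hzX
  have hZg : gr N \ B ⊆ gr N := sdiff_subset
  have hZcard : (gr N \ B).card = rk N (gr N) + 1 := by
    have := card_sdiff_add_card_eq_card (mem_Rq.1 hB).1
    omega
  have hXsub : X ⊆ (gr N \ B).erase z := fun x hx => mem_erase.2 ⟨fun h => hzX (h ▸ hx), hX hx⟩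
  -- the rank of a superset of a dependent set is at most its size minus one
  have h1 : rk N ((gr N \ B).erase z) ≤ ((gr N \ B).erase z).card - 1 := by
    have h2 : rk N ((gr N \ B).erase z) ≤ rk N X + ((gr N \ B).erase z \ X).card := by
      calc rk N ((gr N \ B).erase z) = rk N (X ∪ ((gr N \ B).erase z \ X)) := by
            rw [union_sdiff_of_subset hXsub]
        _ ≤ rk N X + ((gr N \ B).erase z \ X).card := rk_union_le_rk_add_card (N := N) _ _
    have h3 : ((gr N \ B).erase z \ X).card + X.card = ((gr N \ B).erase z).card :=
      card_sdiff_add_card_eq_card hXsub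
    have h4 : rk N X + 1 ≤ X.card := hdep
    have h5 : rk N ((gr N \ B).erase z) + 1 ≤ ((gr N \ B).erase z).card := by
      rw [← h3]
      linarith
    exact Nat.le_sub_one_of_lt h5
  have h4 := rk_le_rk_erase_succ (N := N) hZg z
  have hR3 : 3 ≤ rk N (gr N) := by
    have h6 := rk_mono' (M := N) (mem_Rq.1 hB).1
    have h7 : rk N B = 3 := rk_eq_of_eRk_eq (mem_Rq.1 hB).2
    omega
  have h5 : rk N ((gr N \ B).erase z) + 1 = rk N (gr N \ B) := by
    rw [card_erase_of_mem hzZ, hZcard] at h1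
    omega
  exact hzc (mem_coloops_of_rk_erase hZg hzZ h5)

include hpair hB hBsp in
/-- **The circuit of `E ∖ B` has at least three points on a simple matroid**: `ρ(C₀) + 1 = #C₀`, and a set of one or
two points with that property is a loop or a parallel pair. -/
theorem three_le_card_circuit (hn : (gr N).card = rk N (gr N) + 4) (hB3 : B.card = 3) :
    3 ≤ ((gr N \ B) \ coloops N (gr N \ B)).card := by
  have hZg : gr N \ B ⊆ gr N := sdiff_subset
  have hZcard : (gr N \ B).card = rk N (gr N) + 1 := by
    have := card_sdiff_add_card_eq_card (mem_Rq.1 hB).1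
    omega
  have hCZ : coloops N (gr N \ B) ⊆ gr N \ B := fun z hz => (mem_coloops.1 hz).1
  have h0 := rk_sdiff_add_card_of_subset_coloops hZg (Subset.refl (coloops N (gr N \ B)))
  have h1 := card_sdiff_add_card_eq_card hCZ
  set C₀ := (gr N \ B) \ coloops N (gr N \ B) with hC₀def
  have hC₀g : C₀ ⊆ gr N := sdiff_subset.trans hZg
  -- ρ(C₀) + 1 = #C₀
  have hrk : rk N C₀ + 1 = C₀.card := by omega
  by_contra hlt
  have hle : rk N C₀ ≤ 1 := by omega
  obtain ⟨z, hz⟩ : C₀.Nonempty := card_pos.1 (by omega)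
  rcases Nat.lt_or_ge C₀.card 2 with h1' | h2'
  · -- one point: a loop, but any pair through it has rank 2
    have hC1 : C₀.card = 1 := by omega
    have hrk0 : rk N C₀ = 0 := by omega
    obtain ⟨w, hw⟩ : ((gr N).erase z).Nonempty := by
      apply card_pos.1
      rw [card_erase_of_mem (hC₀g hz)]
      omega
    obtain ⟨hwz, hwg⟩ := mem_erase.1 hw
    have hp := hpair z (hC₀g hz) w hwg (Ne.symm hwz)
    have h3 : rk N {z, w} ≤ rk N (insert w C₀) := by
      apply rk_mono' (M := N)
      intro x hx
      rcases mem_insert.1 hx with rfl | hx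
      · exact mem_insert_of_mem hz
      · rw [mem_singleton.1 hx]
        exact mem_insert_self _ _
    have h4 := rk_insert_le (M := N) w C₀
    omega
  · -- two points: a parallel pair
    have hC2 : C₀.card = 2 := by omega
    obtain ⟨a, b, hab, hC⟩ := card_eq_two.1 hC2
    have hp := hpair a (hC₀g (hC ▸ mem_insert_self a {b})) b
      (hC₀g (hC ▸ mem_insert_of_mem (mem_singleton_self b))) hab
    rw [hC, hp, card_pair hab] at hrk
    omega

include hn hpair hB hBsp hcl hB3 in
/-- **THE FAILING PAIRS NUMBER AT MOST `ρ(E) − 3`** (`ρ(E) ≥ 5`): over the two points `p` of `K = cl B ∖ B`, the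
transversal triples `Y` with `ρ(Y ∪ p) ≠ 4` — those with `Y ∪ p ⊇ C₀`. -/
theorem sum_card_failures_le (hR : 5 ≤ rk N (gr N)) :
    ∑ p ∈ clF N B \ B, ((((gr N \ clF N B).powersetCard 3).filter
      (fun Y => rk N (gr N \ Y) + 1 = rk N (gr N))).filter (fun Y => ¬ rk N (insert p Y) = 4)).card ≤
      rk N (gr N) - 3 := by
  obtain ⟨R, hRdef⟩ : ∃ R, R = rk N (gr N) := ⟨_, rfl⟩
  obtain ⟨K, hKdef⟩ : ∃ K, K = clF N B \ B := ⟨_, rfl⟩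
  obtain ⟨O, hOdef⟩ : ∃ O, O = gr N \ clF N B := ⟨_, rfl⟩
  obtain ⟨C₀, hC₀def⟩ : ∃ C₀, C₀ = (gr N \ B) \ coloops N (gr N \ B) := ⟨_, rfl⟩
  rw [← hRdef, ← hKdef, ← hOdef]
  obtain ⟨𝒯, h𝒯def⟩ : ∃ 𝒯, 𝒯 = (O.powersetCard 3).filter (fun Y => rk N (gr N \ Y) + 1 = R) := ⟨_, rfl⟩
  rw [← h𝒯def]
  have hBg : B ⊆ gr N := (mem_Rq.1 hB).1
  have hK2 : K.card = 2 := hKdef ▸ card_clF_sdiff_of_nullity_four hB hcl hB3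
  have hO : O.card = R - 1 := by rw [hOdef, hRdef]; exact card_sdiff_clF_of_nullity_four hn hcl
  have hC₀3 : 3 ≤ C₀.card := hC₀def ▸ three_le_card_circuit hpair hB hBsp hn hB3
  have hKZ : K ⊆ gr N \ B := fun p hp => by
    rw [hKdef] at hp
    exact mem_sdiff.2 ⟨clF_subset_gr B (mem_sdiff.1 hp).1, (mem_sdiff.1 hp).2⟩
  have hOZ : O ⊆ gr N \ B := fun o ho => by
    rw [hOdef] at ho
    exact mem_sdiff.2 ⟨(mem_sdiff.1 ho).1, fun hoB => (mem_sdiff.1 ho).2 (subset_clF hBg hoB)⟩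
  have hOK : ∀ o ∈ O, o ∉ K := fun o ho hoK => by
    rw [hOdef] at ho
    rw [hKdef] at hoK
    exact (mem_sdiff.1 ho).2 (mem_sdiff.1 hoK).1
  have hYfacts : ∀ Y ∈ 𝒯, Y ⊆ O ∧ Y.card = 3 := fun Y hY => by
    rw [h𝒯def] at hY
    exact mem_powersetCard.1 (mem_filter.1 hY).1
  -- a failing pair contains the circuit
  have hfail : ∀ p ∈ K, ∀ Y ∈ 𝒯.filter (fun Y => ¬ rk N (insert p Y) = 4), C₀ ⊆ insert p Y := by
    intro p hp Y hY
    obtain ⟨hY𝒯, hYne⟩ := mem_filter.1 hY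
    obtain ⟨hYO, hYc⟩ := hYfacts Y hY𝒯
    have hpY : p ∉ Y := fun h => hOK p (hYO h) hp
    have hsub : insert p Y ⊆ gr N \ B := insert_subset (hKZ hp) (hYO.trans hOZ)
    have hcard : (insert p Y).card = 4 := by rw [card_insert_of_notMem hpY, hYc]
    have hle := rk_le_card' (M := N) (insert p Y)
    rw [hC₀def]
    exact circuit_subset_of_dependent hB hBsp hn hB3 hsub (by omega)
  by_cases hKC : ∃ p₀ ∈ K, p₀ ∈ C₀
  · -- case B: a point p₀ of K lies on the circuit — only p₀ has failures
    obtain ⟨p₀, hp₀K, hp₀C⟩ := hKC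
    have hzero : ∀ p ∈ K.erase p₀, (𝒯.filter (fun Y => ¬ rk N (insert p Y) = 4)).card = 0 := by
      intro p hp
      obtain ⟨hpp₀, hpK⟩ := mem_erase.1 hp
      rw [card_eq_zero, filter_eq_empty_iff]
      intro Y hY hYne
      have h := hfail p hpK Y (mem_filter.2 ⟨hY, hYne⟩) hp₀C
      rcases mem_insert.1 h with h | h
      · exact hpp₀ h.symm
      · exact hOK p₀ ((hYfacts Y hY).1 h) hp₀K
    rw [← add_sum_erase K _ hp₀K, sum_eq_zero hzero, add_zero]
    -- the failures at p₀: the triples Y ⊇ D := C₀ ∖ p₀, injected into the (3 − #D)-subsets of O ∖ D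
    obtain ⟨D, hDdef⟩ : ∃ D, D = C₀.erase p₀ := ⟨_, rfl⟩
    have hD2 : 2 ≤ D.card := by rw [hDdef, card_erase_of_mem hp₀C]; omega
    have hDY : ∀ Y ∈ 𝒯.filter (fun Y => ¬ rk N (insert p₀ Y) = 4), D ⊆ Y := by
      intro Y hY x hx
      rw [hDdef] at hx
      obtain ⟨hxp₀, hxC⟩ := mem_erase.1 hx
      rcases mem_insert.1 (hfail p₀ hp₀K Y hY hxC) with h | h
      · exact absurd h hxp₀
      · exact h
    by_cases hne : (𝒯.filter (fun Y => ¬ rk N (insert p₀ Y) = 4)).Nonempty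
    · obtain ⟨Y₀, hY₀⟩ := hne
      have hDO : D ⊆ O := (hDY Y₀ hY₀).trans (hYfacts Y₀ (mem_filter.1 hY₀).1).1
      have hOD : (O \ D).card = R - 1 - D.card := by
        have h := card_sdiff_add_card_eq_card hDO
        omega
      have hinj : (𝒯.filter (fun Y => ¬ rk N (insert p₀ Y) = 4)).card ≤
          ((O \ D).powersetCard (3 - D.card)).card := by
        refine card_le_card_of_injOn (fun Y => Y \ D) (fun Y hY => ?_) (fun Y₁ hY₁ Y₂ hY₂ heq => ?_)
        · obtain ⟨hYO, hYc⟩ := hYfacts Y (mem_filter.1 hY).1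
          refine mem_powersetCard.2 ⟨sdiff_subset_sdiff hYO (Subset.refl D), ?_⟩
          have h := card_sdiff_add_card_eq_card (hDY Y hY)
          show (Y \ D).card = 3 - D.card
          omega
        · simp only at heq
          rw [← union_sdiff_of_subset (hDY Y₁ hY₁), ← union_sdiff_of_subset (hDY Y₂ hY₂), heq]
      rw [card_powersetCard, hOD] at hinj
      exact hinj.trans (choose_sub_le_sub_three R D.card hD2 (hRdef ▸ hR))
    · rw [not_nonempty_iff_eq_empty.1 hne, card_empty]
      exact Nat.zero_le _
  · -- case A: K misses the circuit — each p fails only at Y = C₀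
    have hKC' : ∀ p ∈ K, p ∉ C₀ := fun p hp hpC => hKC ⟨p, hp, hpC⟩
    have hone : ∀ p ∈ K, (𝒯.filter (fun Y => ¬ rk N (insert p Y) = 4)).card ≤ 1 := by
      intro p hp
      rw [card_le_one]
      intro Y₁ hY₁ Y₂ hY₂
      have hsub : ∀ Y ∈ 𝒯.filter (fun Y => ¬ rk N (insert p Y) = 4), Y = C₀ := by
        intro Y hY
        obtain ⟨hYO, hYc⟩ := hYfacts Y (mem_filter.1 hY).1
        have hCY : C₀ ⊆ Y := by
          intro x hx
          rcases mem_insert.1 (hfail p hp Y hY hx) with h | h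
          · exact absurd (h ▸ hx) (hKC' p hp)
          · exact h
        exact (eq_of_subset_of_card_le hCY (by omega)).symm
      rw [hsub Y₁ hY₁, hsub Y₂ hY₂]
    calc ∑ p ∈ K, (𝒯.filter (fun Y => ¬ rk N (insert p Y) = 4)).card ≤ ∑ _p ∈ K, 1 := sum_le_sum hone
      _ = 2 := by rw [sum_const, hK2, smul_eq_mul, mul_one]
      _ ≤ R - 3 := by omega

include hn hpair hcf hB hBsp hcl hB3 in
/-- **EVERY INDEPENDENT DEFICIENT SET HAS AT LEAST `3 (ρ(E) − 3)` UNITS** (`ρ(E) ≥ 5`, simple, coloop-free, nullity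
`4`): the pairs `(p, Y)` with `p ∈ cl B ∖ B`, `Y` a transversal triple of `E ∖ cl B` and `ρ(Y ∪ p) = 4`. -/
theorem card_units_ge (hR : 5 ≤ rk N (gr N)) :
    3 * (rk N (gr N) - 3) ≤
      ((clF N B \ B).sigma (fun p => ((gr N \ clF N B).powersetCard 3).filter
        (fun Y => rk N (gr N \ Y) + 1 = rk N (gr N) ∧ rk N (insert p Y) = 4))).card := by
  have hK2 : (clF N B \ B).card = 2 := card_clF_sdiff_of_nullity_four hB hcl hB3
  have h𝒯 := two_mul_le_card_transversal hn hcf hB hBsp hcl hR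
  have hfail := sum_card_failures_le hpair hn hB hBsp hcl hB3 hR
  rw [card_sigma]
  have hsplit : ∀ p ∈ clF N B \ B,
      (((gr N \ clF N B).powersetCard 3).filter
        (fun Y => rk N (gr N \ Y) + 1 = rk N (gr N) ∧ rk N (insert p Y) = 4)).card +
      ((((gr N \ clF N B).powersetCard 3).filter (fun Y => rk N (gr N \ Y) + 1 = rk N (gr N))).filter
        (fun Y => ¬ rk N (insert p Y) = 4)).card =
      (((gr N \ clF N B).powersetCard 3).filter (fun Y => rk N (gr N \ Y) + 1 = rk N (gr N))).card := by
    intro p _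
    rw [← filter_filter]
    exact card_filter_add_card_filter_not _
  have hsum := sum_congr rfl hsplit
  rw [sum_add_distrib, sum_const, hK2, smul_eq_mul] at hsum
  omega

end Units

end PercRepro.Cogirth
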